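import Mathlib
import Summits.Ventures.PercRepro2.LocRows
import Summits.Ventures.PercRepro2.SwRow
import Summits.Ventures.PercRepro2.SwOut
import Summits.Ventures.PercRepro2.SwAllRow
import Summits.Ventures.PercRepro2.SwOutAll
import Summits.Ventures.PercRepro2.SwOutArmFlip
import Summits.Ventures.PercRepro2.SwOutArmThm
import Summits.Ventures.PercRepro2.SwOutCoreDefs
import Summits.Ventures.PercRepro2.SwOutCoreHull
import Summits.Ventures.PercRepro2.SwOutShadowDefs

/-!
# The shadow data of a one-sided point of a core cube (blind cell PercRepro2, night-4 g13,
2026-08-26; proofs/NIGHT4-G12.md §2 (2.2), proofs/NIGHT4-G13.md §4 (S1))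

A core base `ζ` (every arm red) and a cube point `ω₀` at which `u` is one-sided red — some red
h-arm is adjacent to `u`, no blue h-arm is — determine the SHADOW DATA: `sX` = `u` with the red
arms adjacent to `u` (the coarse arm of `u`), `sZ` = the blue arms adjacent to `u` (all pure: the
DROPPED arms), and the far arms (not adjacent to `u`).  The SHADOW BASE `shadowOf` is the core
base with the edges from `u` into `sZ` turned blue: every arm red, the dropped arms hanging at `u`
by blue edges.  This file: the definitions and their bookkeeping (the dropped arms are pure, the far arms are
h-arms, the region `{h} ∪ sX ∪ far ∪ sZ` is `H`, an edge from `sX` into a dropped or far arm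
leaves from `u`); `SwOutCoreShadow` proves that `shadowOf` is a `ShadowBase`.
-/

namespace Summit.Ventures.PercRepro2

namespace LocRows

open Hull

variable {V : Type*} {E : Type*}

open scoped Classical

variable {ends : E → Sym2 V}

/-- The inside colouring is monotone in the set. -/
lemma insideConfig_mono_set {S S' : Set V} (hS : S ⊆ S') (ζ : Config E) :
    insideConfig ends S ζ ≤ insideConfig ends S' ζ := by
  intro e
  by_cases he : insideConfig ends S ζ e = true
  · rw [he]
    obtain ⟨hζe, x, hx, y, hy, hxy⟩ := insideConfig_eq_true_iff.1 he
    rw [insideConfig_eq_true_iff.2 ⟨hζe, x, hS hx, y, hS hy, hxy⟩]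
  · simp only [Bool.not_eq_true] at he
    rw [he]
    exact Bool.false_le _

section ShadowData

variable {ι : Type*} (ends) (u : V) (A : ι → Set V)

/-- An arm adjacent to `u`. -/
def uAdjC (i : ι) : Prop := ∃ e x, ends e = s(u, x) ∧ x ∈ A i

variable (ω₀ : Config ι)

/-- The coarse arm of `u`: `u` with the red arms adjacent to `u`. -/
def sX : Set V := {u} ∪ {x | ∃ i, uAdjC ends u A i ∧ ω₀ i = true ∧ x ∈ A i}

/-- The dropped arms: the blue arms adjacent to `u`. -/
def sZ : Set V := {x | ∃ i, uAdjC ends u A i ∧ ω₀ i = false ∧ x ∈ A i}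

/-- The arms of the shadow cube: `sX` and the far arms. -/
def sB : Option {i : ι // ¬ uAdjC ends u A i} → Set V
  | none => sX ends u A ω₀
  | some i => A i.1

variable (ζ : Config E) in
/-- The shadow base: the core base with the edges from `u` into the dropped arms turned blue. -/
noncomputable def shadowOf : Config E :=
  fun e => if ∃ z ∈ sZ ends u A ω₀, ends e = s(u, z) then !ζ e else ζ e

end ShadowData

section ShadowLemmas

variable {ι : Type*} {A : ι → Set V} {ζ : Config E} {u : V} {ω₀ : Config ι}

/-- Membership in `sX`. -/
lemma mem_sX_iff {x : V} :
    x ∈ sX ends u A ω₀ ↔ x = u ∨ ∃ i, uAdjC ends u A i ∧ ω₀ i = true ∧ x ∈ A i := by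
  simp only [sX, Set.mem_union, Set.mem_singleton_iff, Set.mem_setOf_eq]

/-- Membership in `sZ`. -/
lemma mem_sZ_iff {x : V} :
    x ∈ sZ ends u A ω₀ ↔ ∃ i, uAdjC ends u A i ∧ ω₀ i = false ∧ x ∈ A i := Iff.rfl

/-- The shadow base on an edge from `u` into the dropped arms. -/
lemma shadowOf_apply_of_mem_sZ {e : E} {z : V} (hz : z ∈ sZ ends u A ω₀) (he : ends e = s(u, z)) :
    shadowOf ends u A ω₀ ζ e = !ζ e := by
  simp only [shadowOf]
  rw [if_pos ⟨z, hz, he⟩]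

/-- The shadow base on an edge not joining `u` to the dropped arms. -/
lemma shadowOf_apply_of_not {e : E} (he : ¬ ∃ z ∈ sZ ends u A ω₀, ends e = s(u, z)) :
    shadowOf ends u A ω₀ ζ e = ζ e := by
  simp only [shadowOf]
  rw [if_neg he]

/-- An edge with no end at `u` keeps its base colour. -/
lemma shadowOf_apply_of_notMem_u {e : E} (he : u ∉ ends e) : shadowOf ends u A ω₀ ζ e = ζ e := by
  apply shadowOf_apply_of_not
  rintro ⟨z, _, hz⟩
  exact he (by rw [hz]; exact Sym2.mem_mk_left _ _)

/-- The inside colouring of a set missing the dropped arms is the base's. -/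
lemma insideConfig_shadowOf {S : Set V} (hS : ∀ z ∈ sZ ends u A ω₀, z ∉ S) :
    insideConfig ends S (shadowOf ends u A ω₀ ζ) = insideConfig ends S ζ := by
  funext e
  simp only [insideConfig]
  by_cases he : e ∈ within ends S
  · obtain ⟨x, hx, y, hy, hxy⟩ := he
    rw [shadowOf_apply_of_not]
    rintro ⟨z, hz, hez⟩
    rw [hxy, Sym2.eq_iff] at hez
    rcases hez with ⟨_, h2⟩ | ⟨h1, _⟩
    · exact hS z hz (h2 ▸ hy)
    · exact hS z hz (h1 ▸ hx)
  · rw [decide_eq_false he]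
    simp

end ShadowLemmas

section ShadowBase

variable {ι : Type*} {A : ι → Set V} {pure : ι → Prop} {ζ : Config E} {h u : V} {H : Set V}
  (hb : CoreBase ends ζ h u H A pure) {ω₀ : Config ι}
include hb

/-- A pure arm is adjacent to `u`. -/
lemma CoreBase.uAdjC_of_pure {i : ι} (hp : pure i) : uAdjC ends u A i := by
  obtain ⟨x, hx⟩ := hb.arm_nonempty i
  have hconn := hb.pure_conn i hp x hx
  by_contra hadj
  have key : x ∈ ({u} : Set V) := by
    refine mem_of_conn_of_closed (ends := ends) (ω := insideConfig ends (A i ∪ {u}) ζ) ?_ rfl hconn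
    intro a ha b hab
    obtain ⟨hne, e, he, hends⟩ := openGraph_adj.1 hab
    rw [Set.mem_singleton_iff] at ha
    subst ha
    obtain ⟨_, y, hy, y', hy', hyy'⟩ := insideConfig_eq_true_iff.1 he
    exfalso
    have hb' : b ∈ A i := by
      rw [hends, Sym2.eq_iff] at hyy'
      rcases hyy' with ⟨_, h2⟩ | ⟨_, h2⟩
      · rcases hy' with hy' | hy'
        · exact h2 ▸ hy'
        · rw [Set.mem_singleton_iff] at hy'; exact absurd (h2.trans hy').symm hne
      · rcases hy with hy | hy
        · exact h2 ▸ hy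
        · rw [Set.mem_singleton_iff] at hy; exact absurd (h2.trans hy).symm hne
    exact hadj ⟨e, b, hends, hb'⟩
  rw [Set.mem_singleton_iff] at key
  exact (hb.arm_sub i x hx).2.2 key

/-- A far arm (not adjacent to `u`) is an h-arm. -/
lemma CoreBase.not_pure_of_not_uAdjC {i : ι} (hi : ¬ uAdjC ends u A i) : ¬ pure i :=
  fun hp => hi (hb.uAdjC_of_pure hp)

/-- An edge from `u` into an arm assigned `true` keeps its base colour. -/
lemma CoreBase.shadowOf_apply_of_mem_arm {e : E} {x : V} {i : ι} (hux : ends e = s(u, x))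
    (hx : x ∈ A i) (hi : ω₀ i = true) : shadowOf ends u A ω₀ ζ e = ζ e := by
  apply shadowOf_apply_of_not
  rintro ⟨z, ⟨j, _, hj, hzj⟩, hz⟩
  rw [hux, Sym2.eq_iff] at hz
  rcases hz with ⟨_, h2⟩ | ⟨h1, _⟩
  · rw [← h2] at hzj
    have : i = j := by
      by_contra hne
      exact hb.arm_disj i j hne x hx hzj
    subst this
    rw [hi] at hj; exact absurd hj (by decide)
  · exact hb.u_notMem_arm j (h1 ▸ hzj)

/-- `{h} ∪ sX ∪ far arms ∪ sZ = H`. -/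
lemma CoreBase.shadow_region_eq :
    {h} ∪ {x | ∃ j, x ∈ sB ends u A ω₀ j} ∪ sZ ends u A ω₀ = H := by
  ext x
  simp only [Set.mem_union, Set.mem_singleton_iff, Set.mem_setOf_eq]
  constructor
  · rintro ((rfl | ⟨j, hj⟩) | hx)
    · exact hb.h_mem
    · rcases j with _ | ⟨i, hi⟩
      · simp only [sB] at hj
        rcases (mem_sX_iff.1 hj) with rfl | ⟨i, _, _, hx⟩
        · exact hb.u_mem
        · exact (hb.arm_sub i x hx).1
      · exact (hb.arm_sub i x hj).1
    · obtain ⟨i, _, _, hx⟩ := hx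
      exact (hb.arm_sub i x hx).1
  · intro hxH
    by_cases hxh : x = h
    · exact Or.inl (Or.inl hxh)
    by_cases hxu : x = u
    · exact Or.inl (Or.inr ⟨none, by simp only [sB]; exact mem_sX_iff.2 (Or.inl hxu)⟩)
    obtain ⟨i, hxi⟩ := hb.arm_cover x hxH hxh hxu
    by_cases hadj : uAdjC ends u A i
    · cases hω : ω₀ i with
      | true =>
        exact Or.inl (Or.inr ⟨none, by
          simp only [sB]; exact mem_sX_iff.2 (Or.inr ⟨i, hadj, hω, hxi⟩)⟩)
      | false => exact Or.inr ⟨i, hadj, hω, hxi⟩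
    · exact Or.inl (Or.inr ⟨some ⟨i, hadj⟩, hxi⟩)

/-- A vertex of `sX` other than `u` lies in a red arm adjacent to `u`. -/
lemma CoreBase.exists_arm_of_mem_sX {x : V} (hx : x ∈ sX ends u A ω₀) (hxu : x ≠ u) :
    ∃ i, uAdjC ends u A i ∧ ω₀ i = true ∧ x ∈ A i := by
  rcases mem_sX_iff.1 hx with rfl | h'
  · exact absurd rfl hxu
  · exact h'

/-- An edge between a vertex of `sX` and a vertex of an arm `A j` assigned `false` or not adjacent
to `u` leaves from `u`. -/
lemma CoreBase.eq_u_of_edge_sX {e : E} {x y : V} {j : ι} (hxy : ends e = s(x, y))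
    (hx : x ∈ sX ends u A ω₀) (hy : y ∈ A j) (hj : ¬ (uAdjC ends u A j ∧ ω₀ j = true)) : x = u := by
  by_contra hxu
  obtain ⟨i, hi, hωi, hxi⟩ := hb.exists_arm_of_mem_sX hx hxu
  have : i = j := hb.arm_eq_of_edge hxy hxi hy
  subst this
  exact hj ⟨hi, hωi⟩

variable (huR : uRed ends A u pure ω₀) (huB : ¬ uRed ends A u pure (flipAll ω₀))
include huR huB

omit hb huR in
/-- A blue arm adjacent to `u` is pure (no blue h-arm is adjacent to `u`). -/
lemma CoreBase.pure_of_mem_sZ {i : ι} (hi : uAdjC ends u A i) (hω : ω₀ i = false) : pure i := by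
  by_contra hp
  obtain ⟨e, x, hux, hx⟩ := hi
  exact huB ⟨i, by simp [flipAll, hω], hp, e, x, hux, hx⟩

end ShadowBase

end LocRows

end Summit.Ventures.PercRepro2
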